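import Literature.MathematicalPhysics.QuantumFieldTheory.Balaban1983to89.Node00.Record11
import Literature.MathematicalPhysics.QuantumFieldTheory.Balaban1983to89.T4OutputRate
import Literature.MathematicalPhysics.QuantumFieldTheory.Balaban1983to89.T4EtaRate

/-!
# NODE 00 (YM-PLAN Track A) — THE RATE-RECORD HOME AT STAGE 11, LAYER A (Literature side): the θ-EXPOSED Stage-11 record key `IsRateKey₁₁`,
# the OBJECT CONTAINERS of the rate carriers (node U3 = N18 ∕ N22 ∕ N17 ∕ (D4): ONE TOWER per construction, its LEVELS as `T4OutputRate.Carriers`,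
# its level functionals, run B through the prepended coupling, the K-UNIFORM letter block; N16's NE3 letters; N15's NE2 families; the spine carriers of
# N19 ∕ N20 ∕ N21) and the RESIDUAL ASSIGNMENTS `RateAssignment₁₁ ∕ SpineAssignment₁₁` that layer B's `RRec₁₁ ∕ SRec₁₁ : YMDAG.UVSplit.RateRecordPred ∕
# SpineRecordPred` read — [Balaban1987RG1] (0.24)–(0.25) p. 257, (1.18)–(1.22) pp. 263–264; [Balaban1988RG2Cluster] (2.13) p. 14, (2.14) p. 15
#   (the history-dependent terms `E^{(k+1)}(X)` and their generic term; the geometric moduli SHAPE `C₉·ω^{k−i}` is the consumers' `FadingMemory` letter, UNPRINTED)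

NODE 00 RATE-RECORD MODULE, LAYER A (cell `pub-ymgap`, HUMAN RULING D-0062 Track A; seat `pub-ymgap-node00-def-RR-1` g0 = the PEN, director-ym R141 (A);
INTENT-1 = pub-ymgap INBOX l.12283, 2026-08-26).  [Balaban1987RG1] = T. Bałaban, *Renormalization group approach to lattice gauge field theories. I*,
Commun. Math. Phys. **109** (1987) 249–301; [Balaban1988RG2Cluster] = *Renormalization group approach to lattice gauge field theories. II. Cluster expansions*,
Commun. Math. Phys. **116** (1988) 1–22; [Balaban1989LargeFieldII] = *Large field renormalization. II*, Commun. Math. Phys. **122** (1989) 355–392;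
[Balaban1988Convergent] = *Convergent renormalization expansions …*, Commun. Math. Phys. **119** (1988) 243–285.

WHY TWO LAYERS (venue fact, reproducible).  The cluster's PARAMETERS `YMDAG.UVSplit.RateRecordPred ∕ SpineRecordPred` and the carrier structures
`RateCarriers = NE1pCarriers × NE2Carriers × NE3Carriers × U3Carriers`, `SpineCarriers` (`Summits/…/YangMills/Theorems/BalabanUVNodesSpineRates.lean`,
`…ClustersCore.lean`) and the tower reading `Spine.NE9.TowerCarriers.TowerData ∕ level ∕ prepend` are SUMMITS-side declarations; `Literature/` never
imports `Summits/`.  Every FIELD TYPE of those structures except the dressed tower `NE1pCarriers.𝒯 : DressedTower P` is Literature-typed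
(`T4OutputRate.Carriers ∕ Functional ∕ Window`, `T4EtaRate.PairedInstance`, `B9.KernelFamily ∕ SiteKernel`, `ℝ ∕ ℕ ∕ Type ∕ Finset`).  So THIS module
(layer A) holds the record key and the OBJECTS, typed over Literature only; layer B (`Summits/…/Theorems/BalabanUVNodesRateRecord11.lean`, prover lane)
assembles `RateCarriers N ∕ SpineCarriers` from them FIELD BY FIELD and defines `RRec₁₁ 𝔯 𝔱 ∕ SRec₁₁ 𝔰` with the one-line home lemmas the consumers
(`…N14AtRecord`, `…N16AtRecord`, `…N17AtRecord11`, `…N18AtRecord`, `…N21ClosenessAtRecord`, `…N22AtRecord*`, `…N19TargetAtRecord11`, `…N20AtSpineCarriers`)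
apply ONCE.

WHAT IS DEFINED (total definitions, `rfl` ∕ `Iff.rfl` faces; 0 estimate).
§1 `IsRateKey₁₁ F N D w θ` := the body of `IsRecordOfRecord₁₁C F N D w` with the Stage-11 parameter `θ` EXPOSED (so that rate LETTERS can be keyed to
   `θ`; the WORLD-FREE canonical key `IsDatumOfRecord₁₁C ∕ .params` the two (T) files share is RR-2's `Node00/Record11DatumKey.lean`, INTENT l.12307 —
   this one is the world-bound reading N17's `hhome` road takes); `isRecordOfRecord₁₁C_iff_exists_isRateKey₁₁` (`Iff.rfl`), the projections (`isRecordOfRecord₁₁C`, `exists_provisos`, `gamma_pos`, `gamma_le`,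
   `L_eq`, `construction_eq`), `exists_world_isRateKey₁₁` (inhabitation = Stage 11's: some admissible θ satisfies its displayed provisos).
§2 NODE U3's OBJECTS OF ONE CONSTRUCTION `U3Objects₁₁`: for every run length `k` the pair carriers `levelCarriers k : T4OutputRate.Carriers` of runs `k`
   (A) and `k + 1` (B), run A's functional `EA k` and run B's first-coupling family `EB k b` on them (the OBJECT is the definer W1's — here FIELDS), and the
   letter block `U3Letters₁₁ = (κ, θ₅, C₅, C₉, ω, cr, ρ)` SHARED BY ALL LEVELS (K-uniform by TYPE: a function of the construction, never of the run
   length) with its history moduli `moduli k i = C₉·ω^{k−i}` (the analytic-slot shape of `…N22AtRecordAnalytic`) and DISPLAYED signs `U3Letters₁₁.Signs`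
   (what N17's (AF-0r), the (D4) read-out and N22's fading rate pin: `0 ≤ κ`, `0 < θ₅ < 1`, `0 ≤ C₅`, `0 ≤ C₉`, `0 ≤ ω < 1`, `0 ≤ cr`, `θ₅ ≤ ρ`, `ω ≤ ρ`,
   `ρ < 1` — a `Prop`, never asserted).  The carrier CONVENTION is left to the instance: TWO constructors of record — the TOWER reading `U3Tower₁₁`
   (ONE physical domain type with first runs `r X` and tree lengths, ONE ambient background type with gauge, one-step transports `tr k`, level functionals
   `E k` — [Balaban1987RG1] (0.24)–(0.25) p. 257, the pairing UNPRINTED, recorded as data exactly as `Spine.NE9.TowerCarriers.TowerData`; `levelCarriers k`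
   is `TowerData.level k` field for field, so layer B's bridge is `rfl`; `EB k b = E (k+1) (b :: g)` through `prependCoupling` = `TowerCarriers.prepend`
   verbatim; `U3Tower₁₁.objects ℓ`) and the FIXED-CARRIER reading `U3Objects₁₁.ofFixed C EA EB ℓ` (one `Carriers` with its functional read at every run
   length — W1's `histCarriers ∕ functional` shape, INTENT W1 l.12155); `windowOfRecord₁₁ w = T4OutputRate.Window w.γ`.
§3 N16's NE3 objects `NE3Objects₁₁ N` (scale-0 period, small-field radius, regularity letters, constants, admissible unit-lattice data) with the block
   factor OF THE RECORD `ne3LOfRecord₁₁ F = F.L` (`two_le_ne3LOfRecord₁₁`: N21's `2 ≤ L`).  §4 N15's NE2 objects `NE2Objects₁₁` (one family of paired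
   instances with its [B9] kernel families).  §5 the spine objects `SpineObjects₁₁` (term-class carriers of N19 ∕ N20 ∕ N21, `DecidableEq` structure-carried,
   no instance).  §6 `RateObjects₁₁ N` (= `u3` once per construction, `ne3 k ∕ ne2 k` per run length — single-scale layers) and the RESIDUAL ASSIGNMENTS `RateAssignment₁₁ N := (F : T4Family) → Stage11Params F N → (ℕ → ℝ) → List (ULoop F)
   → RateObjects₁₁ N`, `SpineAssignment₁₁ N` — EXPLICIT parameters, pinned later BY NAME (W1's functional → `u3.EA ∕ u3.EB`; N16's data → `ne3 k`; N15's instances →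
   `ne2`; the dressed tower of record is Summits-typed and enters layer B as its own parameter `𝔱`), exactly as `ResidB8 ∕ OpsY ∕ ResidZ ∕ ResidW` enter the
   carrier pins; no law assumed.  §7 class consistency: the containers are inhabited (`nonempty_rateObjects₁₁`, `nonempty_spineObjects₁₁`; trivial
   private inhabitants, NO content).  §8 (v1.1) the displayed POPULATEDNESS predicates of the containers and assignments (`Iff.rfl` faces; the sanity
   inhabitant fails them).

## v1.1 (seat g2, 2026-08-26) — APPEND-ONLY: every v1 declaration body byte-identical; two changes

* LOCATOR FIX (dag-ref-H act-(iv) READ-10, the one NIT): v1's «[Balaban1989LargeFieldII] (2.13)–(2.14) p. 359» did not resolve (LF-II p. 359 displays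
  (1.12)–(1.15); LF-II has no (2.13)∕(2.14) display).  The intended source is [II] = [Balaban1988RG2Cluster]: (2.13) p. 14 «E^{(k+1)}(X) = Σ_n (1∕n!)
  Σ_{∪Z_i = X} ρ^T(Z₁,…,Z_n) H(Z₁)⋯H(Z_n)» (the history-dependent terms of the effective action, the OBJECT the definer W1 types in
  `Node00/HistoryTermsOfRecord.lean`) and (2.14) p. 15 (their generic term) — verified on the held scan `paper:balaban1988-cmp116-rg-ii-cluster` p. 14 ∕ p. 15
  (journal page = scan page); the `E`-bounds these terms obey are [Balaban1987RG1] (1.20)–(1.22) p. 264.  HONESTY OF THE MODULI: the geometric weights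
  `C₉·ω^{k−i}` (`U3Letters₁₁.moduli`) are the SHAPE of the consumers' `FadingMemory C ω Λ` letter (node U3 ∕ NE9, a hypothesis of the cluster, NOT in print
  for d = 4); no page of [I], [II] or LF-II displays them — the docstrings now say so.
* §8 DISPLAYED POPULATEDNESS (dag-ref-H READ-10 vacuity note (A1): «the containers admit `I = PEmpty` (the file's own private inhabitant does) — N15's NE2
  predicates are VACUOUSLY TRUE there; a knit `RRec₁₁ 𝔯 → S_N1x` at a NAMED `𝔯` counts only with non-empty index types displayed»): the predicates
  `NE3Objects₁₁.Populated` (`dom.Nonempty`), `NE2Objects₁₁.Populated` (`Nonempty I`), `SpineObjects₁₁.Populated` (`Nonempty ι`), `U3Objects₁₁.Populated`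
  (`∀ k, Nonempty (levelCarriers k).Dom`), `RateObjects₁₁.Populated` (all three layers, every run length), `RateAssignment₁₁.Populated ∕
  SpineAssignment₁₁.Populated` (at every argument) with `Iff.rfl` faces, the two constructor faces (`U3Tower₁₁.populated_objects_iff`,
  `U3Objects₁₁.populated_ofFixed_iff`: populated iff the ONE domain type is non-empty), and the kernel fact that §7's sanity inhabitant is NOT populated
  (`exists_signs_not_populated_rateObjects₁₁`: inhabitation and sign-satisfiability of the containers carry NO content).  Populatedness is a NECESSARY
  display for a contentful knit, never a sufficient one (a populated tower with zero functionals is still junk); class-level non-emptiness of the spine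
  (`(s.T K).Nonempty`) and every node's own `not_s_N1x_of_admits` guard remain the consumers'.

## HONEST FRAMING — what this is NOT

* Containers, one key and readings: kernel bookkeeping.  NOTHING of Bałaban's is asserted; no estimate (NE1′ ∕ NE2 ∕ NE3 ∕ NE4 ∕ NE5 ∕ NE9 are the consumers'
  node statements ABOUT these objects); no node discharged; counts unmoved (typed 28 ∕ 28 · discharged 5 ∕ 28).
* VACUITY STATUS, located: with the objects RESIDUAL, layer B's ∀-stubs `S_N14 … S_N22 (RRec₁₁ 𝔯 𝔱)` are statements about `𝔯`'s objects — contentful for a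
  constructed `𝔯`, refutable for a junk `𝔯` (the consumers' `not_s_N1x_of_admits` guards stand), so a skeleton NAMES its `𝔯`; existence `S_R00x` is free
  for the same reason (a level of the residual tower at the record's own `(θ, w)`), i.e. NOT content.  What IS keyed to the record: `θ` (exposed), the world's
  window `γ = w.γ ≤ θ.γ`, the block factor `L`, the tower shape (admitted bundles = the levels of ONE tower, letters K-uniform — the `NE9.FiniteScaleVacuity`
  junk `C₉ = M·ω^{−K}` is not expressible), the moduli shape `C₉·ω^{k−i}`.
* One finite four-torus programme at fixed `ε`, Bałaban as printed — NOT the continuum limit on ℝ⁴, NOT infinite volume, NOT OS, NOT a mass gap, NOT Clay.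
* No `sorry`, no `axiom`, no `opaque`, no `instance`, no `notation`. -/

noncomputable section

namespace Literature.MathematicalPhysics.QuantumFieldTheory.Balaban1983to89.Node00

open T4Continuum AveragingRT T4FiniteEpsInhabited FlowStep FlowStepRuns DagBinding T4DatumAssembly
open Literature.MathematicalPhysics.QuantumFieldTheory.Balaban1983to89.T4OutputRate (Carriers Functional Window)
open Literature.MathematicalPhysics.QuantumFieldTheory.Balaban1983to89.T4EtaRate (PairedInstance)
open Literature.MathematicalPhysics.QuantumFieldTheory.Balaban1983to89.B9 (KernelFamily SiteKernel)
open scoped Matrix.Norms.L2Operator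

/-! ## §1. The θ-exposed Stage-11 record key -/

section Key

variable (F : T4Family) (N : ℕ) [NeZero N]

/-- **«(D, w) is the Stage-11 record WITH PARAMETERS θ»**: the body of `IsRecordOfRecord₁₁C F N D w` with the Stage-11 parameter EXPOSED — θ is admissible and
satisfies its displayed provisos, its datum of record IS `D`, and the world `w` is bound to the construction with a window `0 < w.γ ≤ θ.γ`, Bałaban's block size and
the C-binding of record.  The rate letters of layer B are functions of this `θ`. [cite: Balaban1989LargeFieldII, Thm 1 + (0.1) pp.355–356; Balaban1987RG1, (0.24)–(0.25) p.257 (objects of record; bookkeeping)] -/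
def IsRateKey₁₁ (D : FiniteEpsData F (SU N)) (w : WorldP) (θ : Stage11Params F N) : Prop :=
  ∃ h : θ.Provisos₁₁, θ.Admissible ∧ D = datumOfRecord₁₁ F N θ h ∧ w.C = D.C ∧ (0 < w.γ ∧ w.γ ≤ θ.γ) ∧
    w.L = (θ.L : ℝ) ∧ ∀ P : B12.RunParams, w.up P = upOfRecord₅C F N (θ.toStage5₁₁ F N) P

/-- **A Stage-11 record IS a keyed record for SOME θ, and conversely** (`Iff.rfl`: the key is `IsRecordOfRecord₁₁C`'s body). [cite: Balaban1989LargeFieldII, Thm 1 + (0.1) pp.355–356 (bookkeeping)] -/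
theorem isRecordOfRecord₁₁C_iff_exists_isRateKey₁₁ (D : FiniteEpsData F (SU N)) (w : WorldP) :
    IsRecordOfRecord₁₁C F N D w ↔ ∃ θ : Stage11Params F N, IsRateKey₁₁ F N D w θ := Iff.rfl

/-- **Pointed form of the key** at the datum of record. [cite: Balaban1989LargeFieldII, Thm 1 + (0.1) pp.355–356 (bookkeeping)] -/
theorem isRateKey₁₁_of_eq (θ : Stage11Params F N) (h : θ.Provisos₁₁) (hθ : θ.Admissible) (w : WorldP)
    (hC : w.C = (datumOfRecord₁₁ F N θ h).C) (hγ : 0 < w.γ ∧ w.γ ≤ θ.γ) (hL : w.L = (θ.L : ℝ))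
    (hup : ∀ P, w.up P = upOfRecord₅C F N (θ.toStage5₁₁ F N) P) :
    IsRateKey₁₁ F N (datumOfRecord₁₁ F N θ h) w θ :=
  ⟨h, hθ, rfl, hC, hγ, hL, hup⟩

/-- **Every admissible θ satisfying its provisos is keyed at some world with any window `0 < γw ≤ θ.γ`** — inhabitation of the keyed class is Stage 11's exactly.
[cite: Balaban1989LargeFieldII, Thm 1 + (0.1) pp.355–356 (bookkeeping)] -/
theorem exists_world_isRateKey₁₁ (θ : Stage11Params F N) (h : θ.Provisos₁₁) (hθ : θ.Admissible) {γw : ℝ} (hγw : 0 < γw ∧ γw ≤ θ.γ) :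
    ∃ w : WorldP, IsRateKey₁₁ F N (datumOfRecord₁₁ F N θ h) w θ ∧ w.γ = γw := by
  obtain ⟨w₀⟩ := nonempty_worldP
  exact ⟨{ w₀ with
      C := (datumOfRecord₁₁ F N θ h).C, γ := γw, L := (θ.L : ℝ), one_lt_L := by exact_mod_cast θ.hL.2,
      up := fun P => upOfRecord₅C F N (θ.toStage5₁₁ F N) P },
    ⟨h, hθ, rfl, rfl, hγw, rfl, fun _ => rfl⟩, rfl⟩

variable {F N}
variable {D : FiniteEpsData F (SU N)} {w : WorldP} {θ : Stage11Params F N}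

/-- A keyed record is a Stage-11 record. [cite: Balaban1989LargeFieldII, Thm 1 + (0.1) pp.355–356 (bookkeeping)] -/
theorem IsRateKey₁₁.isRecordOfRecord₁₁C (hk : IsRateKey₁₁ F N D w θ) : IsRecordOfRecord₁₁C F N D w := ⟨θ, hk⟩

/-- The key CERTIFIES θ's provisos and admissibility and realises `D` as θ's datum of record. [cite: Balaban1989LargeFieldI, (0.3)–(0.4) p.176 (bookkeeping)] -/
theorem IsRateKey₁₁.exists_provisos (hk : IsRateKey₁₁ F N D w θ) : ∃ h : θ.Provisos₁₁, θ.Admissible ∧ D = datumOfRecord₁₁ F N θ h := by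
  obtain ⟨h, hθ, hD, -⟩ := hk
  exact ⟨h, hθ, hD⟩

/-- The key's θ is admissible. [cite: Balaban1987RG1, (1.20)–(1.21) p.264 (hypothesis dictionary; bookkeeping)] -/
theorem IsRateKey₁₁.admissible (hk : IsRateKey₁₁ F N D w θ) : θ.Admissible := by
  obtain ⟨-, hθ, -⟩ := hk
  exact hθ

/-- The world's window is positive. [cite: Balaban1987RG1, Thm 1 p.259 (bookkeeping)] -/
theorem IsRateKey₁₁.gamma_pos (hk : IsRateKey₁₁ F N D w θ) : 0 < w.γ := by
  obtain ⟨-, -, -, -, hγ, -⟩ := hk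
  exact hγ.1

/-- The world's window sits inside θ's coupling window: `w.γ ≤ θ.γ`. [cite: Balaban1987RG1, Thm 1 p.259 (bookkeeping)] -/
theorem IsRateKey₁₁.gamma_le (hk : IsRateKey₁₁ F N D w θ) : w.γ ≤ θ.γ := by
  obtain ⟨-, -, -, -, hγ, -⟩ := hk
  exact hγ.2

/-- The world reads θ's block factor. [cite: Balaban1987RG1, (0.1) p.251 (bookkeeping)] -/
theorem IsRateKey₁₁.L_eq (hk : IsRateKey₁₁ F N D w θ) : w.L = (θ.L : ℝ) := by
  obtain ⟨-, -, -, -, -, hL, -⟩ := hk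
  exact hL

/-- The world is bound to the datum's construction. [cite: Balaban1989LargeFieldII, Thm 1 + (0.1) pp.355–356 (bookkeeping)] -/
theorem IsRateKey₁₁.construction_eq (hk : IsRateKey₁₁ F N D w θ) : w.C = D.C := by
  obtain ⟨-, -, -, hC, -⟩ := hk
  exact hC

/-- The upstream block of the world is the C-binding of record at the Stage-11 view. [cite: Balaban1989LargeFieldII, Thm 1 + (0.1) pp.355–356 (bookkeeping)] -/
theorem IsRateKey₁₁.up_eq (hk : IsRateKey₁₁ F N D w θ) (P : B12.RunParams) : w.up P = upOfRecord₅C F N (θ.toStage5₁₁ F N) P := by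
  obtain ⟨-, -, -, -, -, -, hup⟩ := hk
  exact hup P

end Key

/-! ## §2. Node U3's objects of ONE construction: level carriers, level functionals, the K-uniform letter block; the tower reading -/

/-- **THE K-UNIFORM LETTER BLOCK of one construction** — decay `κ`, NE5 rate `θ₅` and constant `C₅`, fading-memory letters `C₉ ω`, read-out domination `cr`,
joint rate `ρ`: ONE block per construction, hence the same at every level (a letter depending on the run length is not expressible — the
`NE9.FiniteScaleVacuity` junk `C₉ = M·ω^{−K}` is excluded BY TYPE). [cite: Balaban1987RG1, (1.20)–(1.22) p.264 (hypothesis dictionary; objects only)] -/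
structure U3Letters₁₁ where
  /-- decay letter `κ` -/
  κ : ℝ
  /-- NE5 rate `θ` -/
  θ₅ : ℝ
  /-- NE5 constant `C₅` -/
  C₅ : ℝ
  /-- fading-memory constant `C₉` -/
  C₉ : ℝ
  /-- fading-memory rate `ω` -/
  ω : ℝ
  /-- read-out domination constant `cr` -/
  cr : ℝ
  /-- joint rate `ρ ≥ max θ ω` -/
  ρ : ℝ

namespace U3Letters₁₁

variable (ℓ : U3Letters₁₁)

/-- The HISTORY MODULI of the analytic slot: `Λ k i = C₉ · ω ^ (k − i)` — the weights the consumers' `FadingMemory` letter puts on the HISTORY-DEPENDENT TERMS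
`E^{(k+1)}(X)` of [II] (2.13) and their generic term (2.14); the geometric SHAPE itself is NOT a printed display (hypothesis dictionary). [cite: Balaban1988RG2Cluster, (2.13) p.14, (2.14) p.15 (history terms; objects only); Balaban1987RG1, (1.20)–(1.22) p.264 (hypothesis dictionary)] -/
def moduli : ℕ → ℕ → ℝ := fun k i => ℓ.C₉ * ℓ.ω ^ (k - i)

/-- Face: `moduli k i = C₉ · ω ^ (k − i)`. [cite: Balaban1988RG2Cluster, (2.13) p.14, (2.14) p.15 (bookkeeping)] -/
theorem moduli_apply (k i : ℕ) : ℓ.moduli k i = ℓ.C₉ * ℓ.ω ^ (k - i) := rfl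

/-- **THE DISPLAYED LETTER SIGNS** (what N17's (AF-0r), the (D4) read-out binders and N22's fading rate pin) — a `Prop`, certified by whoever constructs the objects,
never asserted. [cite: Balaban1987RG1, (1.20)–(1.22) p.264 (hypothesis dictionary)] -/
structure Signs : Prop where
  κ_nonneg : 0 ≤ ℓ.κ
  θ₅_pos : 0 < ℓ.θ₅
  θ₅_lt_one : ℓ.θ₅ < 1
  C₅_nonneg : 0 ≤ ℓ.C₅
  C₉_nonneg : 0 ≤ ℓ.C₉
  ω_nonneg : 0 ≤ ℓ.ω
  ω_lt_one : ℓ.ω < 1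
  cr_nonneg : 0 ≤ ℓ.cr
  θ₅_le_ρ : ℓ.θ₅ ≤ ℓ.ρ
  ω_le_ρ : ℓ.ω ≤ ℓ.ρ
  ρ_lt_one : ℓ.ρ < 1

/-- Under the signs, `ρ` is nonnegative. [cite: Balaban1987RG1, (1.20)–(1.22) p.264 (bookkeeping)] -/
theorem Signs.ρ_nonneg {ℓ : U3Letters₁₁} (h : ℓ.Signs) : 0 ≤ ℓ.ρ := h.ω_nonneg.trans h.ω_le_ρ

/-- Under the signs, the moduli are nonnegative. [cite: Balaban1988RG2Cluster, (2.13) p.14, (2.14) p.15 (bookkeeping)] -/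
theorem Signs.moduli_nonneg {ℓ : U3Letters₁₁} (h : ℓ.Signs) (k i : ℕ) : 0 ≤ ℓ.moduli k i :=
  mul_nonneg h.C₉_nonneg (pow_nonneg h.ω_nonneg _)

end U3Letters₁₁

/-- **NODE U3's OBJECTS OF ONE CONSTRUCTION**: for every run length `k` the PAIR CARRIERS of runs `k` (A) and `k + 1` (B) (`T4OutputRate.Carriers`: localization
domains with scale and tree length, the two background types, the closeness gauge, the B → A transport — the UNPRINTED pairing recorded as data), run A's
functional `EA k` and run B's first-coupling family `EB k b` on them, and the K-uniform letter block (`extends U3Letters₁₁`).  The carrier CONVENTION is not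
fixed here: the tower reading (`U3Tower₁₁.objects`: one physical domain type, level `k` = `TowerData.level k` field for field) and the fixed-carrier reading
(`U3Objects₁₁.ofFixed`: one `Carriers` with its functional read at every run length — the definer W1's `histCarriers ∕ functional` shape) are its two
constructors of record. [cite: Balaban1987RG1, (0.24)–(0.25) p.257, (1.18) p.263; Balaban1988RG2Cluster, (2.13) p.14, (2.14) p.15 (objects; the pairing is NOT printed)] -/
structure U3Objects₁₁ extends U3Letters₁₁ where
  /-- the pair carriers at run length `k` -/
  levelCarriers : ℕ → Carriers
  /-- run A's functional at run length `k` -/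
  EA : ∀ k, Functional (levelCarriers k) (levelCarriers k).BgA
  /-- run B's first-coupling family at run length `k` -/
  EB : ∀ k, ℝ → Functional (levelCarriers k) (levelCarriers k).BgB

/-- **Prepending run `k + 1`'s UNPAIRED bare coupling `b` to a re-indexed history `g`** (run B's step-0 coupling has no partner under `j ↦ j + 1`); the Literature
twin of `Spine.NE9.TowerCarriers.prepend` (layer B: `prependCoupling = prepend` by `funext; cases`). [cite: Balaban1987RG1, (0.24)–(0.25) p.257 (re-indexing; bookkeeping)] -/
def prependCoupling (b : ℝ) (g : ℕ → ℝ) : ℕ → ℝ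
  | 0 => b
  | i + 1 => g i

/-- `prependCoupling b g 0 = b`. [cite: Balaban1987RG1, (0.24)–(0.25) p.257 (bookkeeping)] -/
theorem prependCoupling_zero (b : ℝ) (g : ℕ → ℝ) : prependCoupling b g 0 = b := rfl

/-- `prependCoupling b g (i + 1) = g i`. [cite: Balaban1987RG1, (0.24)–(0.25) p.257 (bookkeeping)] -/
theorem prependCoupling_succ (b : ℝ) (g : ℕ → ℝ) (i : ℕ) : prependCoupling b g (i + 1) = g i := rfl

/-- A history is its oldest coupling prepended to its tail. [cite: Balaban1987RG1, (0.24)–(0.25) p.257 (bookkeeping)] -/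
theorem prependCoupling_head_tail (g : ℕ → ℝ) : prependCoupling (g 0) (fun i => g (i + 1)) = g := by
  funext i
  cases i <;> rfl

/-- **THE TOWER READING of one construction** (UNPRINTED pairing conventions recorded as DATA; the fields of `Spine.NE9.TowerCarriers.TowerData` plus the level
functionals): an index type of PHYSICAL localization domains `X` with `r X` = the run in which `X` has scale index `0` and the tree length `d X ≥ 0`; ONE ambient
background type `B` for all runs with a closeness gauge; the one-step background transports `tr k : B → B` (run `k + 1` → run `k`, one block averaging); the LEVEL
FUNCTIONALS `E k g U X` = `E^{(j)}(X; g⃗, U)` read at run length `k` (the OBJECT is the definer's; here a field). [cite: Balaban1987RG1, (0.24)–(0.25) p.257, (1.18) p.263 (objects; the pairing is NOT printed)] -/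
structure U3Tower₁₁ where
  /-- index type of physical localization domains -/
  Dom : Type
  /-- the run in which `X` has scale index `0` -/
  r : Dom → ℕ
  /-- tree length of `X` in the units of its own scale -/
  d : Dom → ℝ
  d_nonneg : ∀ X, 0 ≤ d X
  /-- ambient background type, all runs -/
  B : Type
  /-- closeness gauge on backgrounds -/
  gauge : B → B → ℝ
  gauge_nonneg : ∀ U U', 0 ≤ gauge U U'
  /-- background transport run `k + 1` → run `k` -/
  tr : ℕ → B → B
  /-- the level functionals `E k g U X` -/
  E : ℕ → (ℕ → ℝ) → B → Dom → ℝ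

namespace U3Tower₁₁

variable (t : U3Tower₁₁)

/-- **THE LEVEL-`k` PAIR CARRIERS of the tower**: runs `k` (A) and `k + 1` (B) — scale `k − r X`, both background slots the ambient type, transport `tr k`
(field-for-field `TowerData.level`, so layer B's bridge is `rfl`). [cite: Balaban1987RG1, (0.24)–(0.25) p.257 and §1 p.263 (carriers; bookkeeping)] -/
def levelCarriers (k : ℕ) : Carriers where
  Dom := t.Dom
  scale := fun X => k - t.r X
  d := t.d
  d_nonneg := t.d_nonneg
  BgA := t.B
  BgB := t.B
  gauge := t.gauge
  gauge_nonneg := t.gauge_nonneg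
  transport := t.tr k

/-- Run A's functional at level `k`: the level functional itself. [cite: Balaban1987RG1, (1.18) p.263 (bookkeeping)] -/
def EA (k : ℕ) : Functional (t.levelCarriers k) t.B := t.E k

/-- Run B's first-coupling family at level `k`: the level-`(k + 1)` functional with run B's first coupling `b` PREPENDED.
[cite: Balaban1987RG1, (1.18)–(1.22) pp.263–264 (bookkeeping)] -/
def EB (k : ℕ) : ℝ → Functional (t.levelCarriers k) t.B := fun b g U X => t.E (k + 1) (prependCoupling b g) U X

/-- **THE U3 OBJECTS OF A TOWER with letter block `ℓ`.** [cite: Balaban1987RG1, (0.24)–(0.25) p.257, (1.18)–(1.22) pp.263–264 (bookkeeping)] -/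
def objects (ℓ : U3Letters₁₁) : U3Objects₁₁ :=
  { ℓ with levelCarriers := t.levelCarriers, EA := t.EA, EB := t.EB }

/-- Face: the level carriers' domains are the tower's. [cite: Balaban1987RG1, (0.24)–(0.25) p.257 (bookkeeping)] -/
theorem levelCarriers_Dom (k : ℕ) : (t.levelCarriers k).Dom = t.Dom := rfl

/-- Face: the scale of `X` at level `k` is `k − r X`. [cite: Balaban1987RG1, (0.24)–(0.25) p.257 (bookkeeping)] -/
theorem levelCarriers_scale (k : ℕ) (X : t.Dom) : (t.levelCarriers k).scale X = k - t.r X := rfl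

/-- Face: the transport at level `k` is `tr k`. [cite: Balaban1987RG1, §1 p.263 (bookkeeping)] -/
theorem levelCarriers_transport (k : ℕ) : (t.levelCarriers k).transport = t.tr k := rfl

/-- Face: `EA k = E k`. [cite: Balaban1987RG1, (1.18) p.263 (bookkeeping)] -/
theorem EA_apply (k : ℕ) (g : ℕ → ℝ) (U : t.B) (X : t.Dom) : t.EA k g U X = t.E k g U X := rfl

/-- Face: `EB k b g = E (k+1) (b :: g)`. [cite: Balaban1987RG1, (1.18)–(1.22) pp.263–264 (bookkeeping)] -/
theorem EB_apply (k : ℕ) (b : ℝ) (g : ℕ → ℝ) (U : t.B) (X : t.Dom) : t.EB k b g U X = t.E (k + 1) (prependCoupling b g) U X := rfl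

/-- Face: the objects of a tower read the tower's level carriers. [cite: Balaban1987RG1, (0.24)–(0.25) p.257 (bookkeeping)] -/
theorem objects_levelCarriers (ℓ : U3Letters₁₁) (k : ℕ) : (t.objects ℓ).levelCarriers k = t.levelCarriers k := rfl

/-- Face: … and its level functionals. [cite: Balaban1987RG1, (1.18) p.263 (bookkeeping)] -/
theorem objects_EA (ℓ : U3Letters₁₁) (k : ℕ) : (t.objects ℓ).EA k = t.EA k := rfl

/-- Face: … and its prepended family. [cite: Balaban1987RG1, (1.18)–(1.22) pp.263–264 (bookkeeping)] -/
theorem objects_EB (ℓ : U3Letters₁₁) (k : ℕ) : (t.objects ℓ).EB k = t.EB k := rfl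

/-- Face: … and carries the letter block unchanged. [cite: Balaban1987RG1, (1.20)–(1.22) p.264 (bookkeeping)] -/
theorem objects_toU3Letters₁₁ (ℓ : U3Letters₁₁) : (t.objects ℓ).toU3Letters₁₁ = ℓ := rfl

end U3Tower₁₁

namespace U3Objects₁₁

/-- **THE FIXED-CARRIER READING**: ONE pair-carrier structure `C` with run A's functional and run B's first-coupling family read at every run length (the definer
W1's `histCarriers ∕ functional` shape), letter block `ℓ`. [cite: Balaban1988RG2Cluster, (2.13) p.14, (2.14) p.15 (objects; bookkeeping)] -/
def ofFixed (C : Carriers) (EA : Functional C C.BgA) (EB : ℝ → Functional C C.BgB) (ℓ : U3Letters₁₁) : U3Objects₁₁ :=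
  { ℓ with levelCarriers := fun _ => C, EA := fun _ => EA, EB := fun _ => EB }

/-- Face (`rfl`). [cite: Balaban1988RG2Cluster, (2.13) p.14, (2.14) p.15 (bookkeeping)] -/
theorem ofFixed_levelCarriers (C : Carriers) (EA : Functional C C.BgA) (EB : ℝ → Functional C C.BgB) (ℓ : U3Letters₁₁) (k : ℕ) :
    (ofFixed C EA EB ℓ).levelCarriers k = C := rfl

/-- Face (`rfl`). [cite: Balaban1988RG2Cluster, (2.13) p.14, (2.14) p.15 (bookkeeping)] -/
theorem ofFixed_EA (C : Carriers) (EA : Functional C C.BgA) (EB : ℝ → Functional C C.BgB) (ℓ : U3Letters₁₁) (k : ℕ) : (ofFixed C EA EB ℓ).EA k = EA := rfl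

/-- Face (`rfl`). [cite: Balaban1988RG2Cluster, (2.13) p.14, (2.14) p.15 (bookkeeping)] -/
theorem ofFixed_EB (C : Carriers) (EA : Functional C C.BgA) (EB : ℝ → Functional C C.BgB) (ℓ : U3Letters₁₁) (k : ℕ) : (ofFixed C EA EB ℓ).EB k = EB := rfl

/-- Face (`rfl`). [cite: Balaban1987RG1, (1.20)–(1.22) p.264 (bookkeeping)] -/
theorem ofFixed_toU3Letters₁₁ (C : Carriers) (EA : Functional C C.BgA) (EB : ℝ → Functional C C.BgB) (ℓ : U3Letters₁₁) :
    (ofFixed C EA EB ℓ).toU3Letters₁₁ = ℓ := rfl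

variable (u : U3Objects₁₁)

/-- The objects' history moduli are the letter block's: `u.moduli k i = C₉ · ω ^ (k − i)` (spelling `u.moduli` of record). [cite: Balaban1988RG2Cluster, (2.13) p.14, (2.14) p.15 (bookkeeping)] -/
theorem moduli_eq (k i : ℕ) : u.moduli k i = u.C₉ * u.ω ^ (k - i) := rfl

end U3Objects₁₁

/-- **THE COUPLING WINDOW OF THE RECORD**: `]0, w.γ]^ℕ`, the world's window. [cite: Balaban1987RG1, Thm 1 p.259] -/
def windowOfRecord₁₁ (w : WorldP) : Set (ℕ → ℝ) := Window w.γ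

/-- Face (`Iff.rfl`). [cite: Balaban1987RG1, Thm 1 p.259 (bookkeeping)] -/
theorem mem_windowOfRecord₁₁_iff (w : WorldP) (g : ℕ → ℝ) : g ∈ windowOfRecord₁₁ w ↔ ∀ i, 0 < g i ∧ g i ≤ w.γ := Iff.rfl

/-! ## §3. N16's NE3 objects; the block factor of the record -/

/-- **N16's NE3 OBJECTS** (colour index `Fin N`): scale-0 period `Nper`, small-field radius `ε`, regularity letters `b g`, constants `C Λ₁ Λ₂'`, admissible
unit-lattice data `dom` (configurations `(Fin 4 → ℤ) → Fin 4 → M_N(ℂ)ˣ`, the type of `NE3Carriers.dom`).  The block factor is NOT a field: it is the record's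
(`ne3LOfRecord₁₁`). [cite: Balaban1985UV3, (1)-(3) p.256 (letters; objects only)] -/
structure NE3Objects₁₁ (N : ℕ) where
  Nper : ℕ
  ε : ℝ
  b : ℝ
  g : ℝ
  C : ℝ
  Λ₁ : ℝ
  Λ₂' : ℝ
  dom : Set ((Fin 4 → ℤ) → Fin 4 → (Matrix (Fin N) (Fin N) ℂ)ˣ)

/-- **THE BLOCK FACTOR OF THE RECORD** read by N16 ∕ N21: `L = F.L`. [cite: Balaban1987RG1, (0.1) p.251] -/
def ne3LOfRecord₁₁ (F : T4Family) : ℕ := F.L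

/-- Face (`rfl`). [cite: Balaban1987RG1, (0.1) p.251 (bookkeeping)] -/
theorem ne3LOfRecord₁₁_eq (F : T4Family) : ne3LOfRecord₁₁ F = F.L := rfl

/-- `2 ≤ L` (indeed `11 < L`, [Balaban1987RG1] p. 251) — N21's letter clause. [cite: Balaban1987RG1, (0.1) p.251 (bookkeeping)] -/
theorem two_le_ne3LOfRecord₁₁ (F : T4Family) : 2 ≤ ne3LOfRecord₁₁ F := by
  have := F.hL11
  unfold ne3LOfRecord₁₁
  omega

/-- `1 < L` as a real number. [cite: Balaban1987RG1, (0.1) p.251 (bookkeeping)] -/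
theorem one_lt_ne3LOfRecord₁₁_real (F : T4Family) : (1 : ℝ) < (ne3LOfRecord₁₁ F : ℝ) := by
  have := two_le_ne3LOfRecord₁₁ F
  exact_mod_cast (by omega : 1 < ne3LOfRecord₁₁ F)

/-! ## §4. N15's NE2 objects -/

/-- **N15's NE2 OBJECTS**: one family of paired instances with its [B9] kernel families (operator ∕ site ∕ unit), kernel exponent `p`, regularity letter `c35`,
the volume predicates and unit distances (the fields of `NE2Carriers`). [cite: King1986, Prop. 3.9 (3.73) p.665 (objects only)] -/
structure NE2Objects₁₁ where
  I : Type
  c35 : ℝ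
  p : ℝ
  pi : I → PairedInstance
  Kop : ∀ i, KernelFamily (pi i).gc (pi i).Bf
  Ksite : ∀ i, SiteKernel (pi i).gc (pi i).Bf
  Kunit : ∀ i, SiteKernel (pi i).gc (pi i).Bf
  inΛ : ∀ i, (pi i).gc.Site → Prop
  unitDist : ∀ i, (pi i).gc.Site → (pi i).gc.Site → ℝ

/-! ## §5. The spine objects (N19 ∕ N20 ∕ N21's term-class carriers) -/

/-- **THE SPINE OBJECTS** of Bałaban's two runs: index type `ι` of term-class members (its `DecidableEq` structure-carried, used term-locally, NO instance), source
radius `l₀`, volume `vol`, offset `K₀`, the classes `T K`, activities `A B` and their shell parts `shA shB`, the bad sets, class weights `W Wsh`, remainder `δ`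
(the fields of `SpineCarriers`). [cite: Balaban1987RG1, (0.24)–(0.27) pp.257–258 (objects only)] -/
structure SpineObjects₁₁ where
  ι : Type
  dec : DecidableEq ι
  l₀ : ℝ
  vol : ℝ
  K₀ : ℕ
  T : ℕ → Finset ι
  A : ℕ → ℝ → ι → ℝ
  B : ℕ → ℝ → ι → ℝ
  shA : ℕ → ℝ → ι → ℝ
  shB : ℕ → ℝ → ι → ℝ
  Bad : ℕ → ℝ → Finset ι
  W : ℕ → ℝ
  Wsh : ℕ → ℝ
  δ : ℕ → ℝ

/-! ## §6. The rate objects of one construction and the residual assignments -/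

/-- **THE RATE OBJECTS OF ONE CONSTRUCTION** (Literature-typed layers; the dressed tower of N14 is Summits-typed and joins in layer B): node U3's objects
once per construction, the single-scale layers NE3 ∕ NE2 per run length `k` (the bundle at run length `k` reads `u3`'s level `k`, `ne3 k`, `ne2 k`).
[cite: Balaban1987RG1, (0.24)–(0.25) p.257, (1.18)–(1.22) pp.263–264 (objects only)] -/
structure RateObjects₁₁ (N : ℕ) where
  /-- node U3's objects (ONE per construction; bundles = its run lengths `k`) -/
  u3 : U3Objects₁₁
  /-- N16's single-scale objects at run length `k` (a constant family is the K-uniform case) -/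
  ne3 : ℕ → NE3Objects₁₁ N
  /-- N15's single-scale objects at run length `k` -/
  ne2 : ℕ → NE2Objects₁₁

/-- **THE RESIDUAL RATE ASSIGNMENT**: the rate objects of the construction with family `F`, Stage-11 parameters `θ`, tuned bare sequence `g₀`, loop string `os` —
an EXPLICIT parameter of layer B's `RRec₁₁`, pinned later by name; no law assumed. [cite: Balaban1987RG1, (1.18)–(1.22) pp.263–264 (objects only)] -/
abbrev RateAssignment₁₁ (N : ℕ) [NeZero N] := (F : T4Family) → Stage11Params F N → (ℕ → ℝ) → List (ULoop F) → RateObjects₁₁ N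

/-- **THE RESIDUAL SPINE ASSIGNMENT**, likewise, read by layer B's `SRec₁₁`. [cite: Balaban1987RG1, (0.24)–(0.27) pp.257–258 (objects only)] -/
abbrev SpineAssignment₁₁ (N : ℕ) [NeZero N] := (F : T4Family) → Stage11Params F N → (ℕ → ℝ) → List (ULoop F) → SpineObjects₁₁

namespace RateObjects₁₁

variable {N : ℕ}

/-- Reading: the letters of the rate objects are those of its U3 letter block (K-uniform: no run-length argument exists). [cite: Balaban1987RG1, (1.20)–(1.22) p.264 (bookkeeping)] -/
theorem u3_moduli (o : RateObjects₁₁ N) (k i : ℕ) : o.u3.moduli k i = o.u3.C₉ * o.u3.ω ^ (k - i) := rfl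

end RateObjects₁₁

/-! ## §7. Class consistency: the containers are inhabited (trivial inhabitants, NO content) -/

section Sanity

variable (N : ℕ)

/-- Trivial tower (one domain, one background, zero functionals) — class-consistency plumbing only, NO content. [folklore] -/
private def trivialU3Tower₁₁ : U3Tower₁₁ where
  Dom := Unit
  r := fun _ => 0
  d := fun _ => 0
  d_nonneg := fun _ => le_rfl
  B := Unit
  gauge := fun _ _ => 0
  gauge_nonneg := fun _ _ => le_rfl
  tr := fun _ U => U
  E := fun _ _ _ _ => 0

/-- Trivial letter block `(0, ½, 0, 0, 0, 0, ½)` — plumbing only. [folklore] -/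
private def trivialU3Letters₁₁ : U3Letters₁₁ where
  κ := 0
  θ₅ := 1 / 2
  C₅ := 0
  C₉ := 0
  ω := 0
  cr := 0
  ρ := 1 / 2

/-- The trivial letter block satisfies the displayed signs — private helper. [folklore] -/
private theorem trivialU3Letters₁₁_signs : (trivialU3Letters₁₁).Signs := by
  constructor <;> norm_num [trivialU3Letters₁₁]

/-- Trivial U3 objects (the trivial tower with the trivial letters) — plumbing only. [folklore] -/
private def trivialU3Objects₁₁ : U3Objects₁₁ := trivialU3Tower₁₁.objects trivialU3Letters₁₁

/-- Trivial NE3 objects (zero letters, empty data) — plumbing only. [folklore] -/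
private def trivialNE3Objects₁₁ : NE3Objects₁₁ N where
  Nper := 1
  ε := 0
  b := 0
  g := 0
  C := 0
  Λ₁ := 0
  Λ₂' := 0
  dom := ∅

/-- Trivial NE2 objects (empty family) — plumbing only. [folklore] -/
private def trivialNE2Objects₁₁ : NE2Objects₁₁ where
  I := PEmpty
  c35 := 0
  p := 0
  pi := fun i => nomatch i
  Kop := fun i => nomatch i
  Ksite := fun i => nomatch i
  Kunit := fun i => nomatch i
  inΛ := fun i => nomatch i
  unitDist := fun i => nomatch i

/-- Trivial spine objects (one-point index, empty classes, zero weights) — plumbing only. [folklore] -/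
private def trivialSpineObjects₁₁ : SpineObjects₁₁ where
  ι := Unit
  dec := inferInstance
  l₀ := 0
  vol := 0
  K₀ := 0
  T := fun _ => ∅
  A := fun _ _ _ => 0
  B := fun _ _ _ => 0
  shA := fun _ _ _ => 0
  shB := fun _ _ _ => 0
  Bad := fun _ _ => ∅
  W := fun _ => 0
  Wsh := fun _ => 0
  δ := fun _ => 0

/-- The rate-object container is inhabited, with the letter signs satisfiable (class consistency only; NO content). [cite: Balaban1987RG1, (1.20)–(1.22) p.264 (bookkeeping)] -/
theorem nonempty_rateObjects₁₁_signs : ∃ o : RateObjects₁₁ N, o.u3.Signs :=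
  ⟨⟨trivialU3Objects₁₁, fun _ => trivialNE3Objects₁₁ N, fun _ => trivialNE2Objects₁₁⟩, trivialU3Letters₁₁_signs⟩

/-- The rate-object container is inhabited. [cite: Balaban1987RG1, (1.20)–(1.22) p.264 (bookkeeping)] -/
theorem nonempty_rateObjects₁₁ : Nonempty (RateObjects₁₁ N) :=
  let ⟨o, _⟩ := nonempty_rateObjects₁₁_signs N
  ⟨o⟩

/-- The spine-object container is inhabited. [cite: Balaban1987RG1, (0.24)–(0.27) pp.257–258 (bookkeeping)] -/
theorem nonempty_spineObjects₁₁ : Nonempty SpineObjects₁₁ := ⟨trivialSpineObjects₁₁⟩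

/-- Hence every residual assignment type is inhabited (the constant assignments). [cite: Balaban1987RG1, (1.20)–(1.22) p.264 (bookkeeping)] -/
theorem nonempty_rateAssignment₁₁ [NeZero N] : Nonempty (RateAssignment₁₁ N) :=
  let ⟨o⟩ := nonempty_rateObjects₁₁ N
  ⟨fun _ _ _ _ => o⟩

/-- … and the spine assignments. [cite: Balaban1987RG1, (0.24)–(0.27) pp.257–258 (bookkeeping)] -/
theorem nonempty_spineAssignment₁₁ [NeZero N] : Nonempty (SpineAssignment₁₁ N) :=
  let ⟨s⟩ := nonempty_spineObjects₁₁
  ⟨fun _ _ _ _ => s⟩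

end Sanity

/-! ## §8. Displayed populatedness of the containers and of the residual assignments (v1.1; dag-ref-H READ-10 (A1)) -/

section Populated

variable {N : ℕ}

/-- **N16's NE3 objects are POPULATED**: the admissible unit-lattice data are non-empty (an empty `dom` makes every «for all admissible `U`» clause of NE3
vacuous). [cite: Balaban1985UV3, (1)-(3) p.256 (objects only; display of non-degeneracy)] -/
def NE3Objects₁₁.Populated (o : NE3Objects₁₁ N) : Prop := o.dom.Nonempty

/-- Face (`Iff.rfl`). [cite: Balaban1985UV3, (1)-(3) p.256 (bookkeeping)] -/
theorem NE3Objects₁₁.populated_iff (o : NE3Objects₁₁ N) : o.Populated ↔ o.dom.Nonempty := Iff.rfl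

/-- **N15's NE2 objects are POPULATED**: the index type of paired instances is non-empty (at `I = PEmpty` — §7's sanity inhabitant — N15's NE2 predicates
are vacuously true; dag-ref-H READ-10 (A1)). [cite: King1986, Prop. 3.9 (3.73) p.665 (objects only; display of non-degeneracy)] -/
def NE2Objects₁₁.Populated (o : NE2Objects₁₁) : Prop := Nonempty o.I

/-- Face (`Iff.rfl`). [cite: King1986, Prop. 3.9 (3.73) p.665 (bookkeeping)] -/
theorem NE2Objects₁₁.populated_iff (o : NE2Objects₁₁) : o.Populated ↔ Nonempty o.I := Iff.rfl

/-- **The spine objects are POPULATED**: the index type of term-class members is non-empty.  (Class-level non-emptiness `(s.T K).Nonempty` is the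
consumers' own guard and is NOT displayed here.) [cite: Balaban1987RG1, (0.24)–(0.27) pp.257–258 (objects only; display of non-degeneracy)] -/
def SpineObjects₁₁.Populated (s : SpineObjects₁₁) : Prop := Nonempty s.ι

/-- Face (`Iff.rfl`). [cite: Balaban1987RG1, (0.24)–(0.27) pp.257–258 (bookkeeping)] -/
theorem SpineObjects₁₁.populated_iff (s : SpineObjects₁₁) : s.Populated ↔ Nonempty s.ι := Iff.rfl

/-- **Node U3's objects are POPULATED**: at every run length the pair carriers have a localization domain (an empty `Dom` makes every «for all `X`» clause
of NE5 ∕ NE9 ∕ the (D4) read-out vacuous). [cite: Balaban1987RG1, (0.24)–(0.25) p.257 (objects only; display of non-degeneracy)] -/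
def U3Objects₁₁.Populated (u : U3Objects₁₁) : Prop := ∀ k, Nonempty (u.levelCarriers k).Dom

/-- Face (`Iff.rfl`). [cite: Balaban1987RG1, (0.24)–(0.25) p.257 (bookkeeping)] -/
theorem U3Objects₁₁.populated_iff (u : U3Objects₁₁) : u.Populated ↔ ∀ k, Nonempty (u.levelCarriers k).Dom := Iff.rfl

/-- Constructor face: the objects of a TOWER are populated iff its one physical domain type is non-empty. [cite: Balaban1987RG1, (0.24)–(0.25) p.257 (bookkeeping)] -/
theorem U3Tower₁₁.populated_objects_iff (t : U3Tower₁₁) (ℓ : U3Letters₁₁) : (t.objects ℓ).Populated ↔ Nonempty t.Dom :=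
  ⟨fun h => h 0, fun h _ => h⟩

/-- Constructor face: the FIXED-CARRIER objects are populated iff the one carrier's domain type is non-empty. [cite: Balaban1988RG2Cluster, (2.13) p.14, (2.14) p.15 (bookkeeping)] -/
theorem U3Objects₁₁.populated_ofFixed_iff (C : Carriers) (EA : Functional C C.BgA) (EB : ℝ → Functional C C.BgB) (ℓ : U3Letters₁₁) :
    (U3Objects₁₁.ofFixed C EA EB ℓ).Populated ↔ Nonempty C.Dom :=
  ⟨fun h => h 0, fun h _ => h⟩

/-- **The rate objects of one construction are POPULATED**: node U3's objects and, at every run length, the NE3 and NE2 layers.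
[cite: Balaban1987RG1, (0.24)–(0.25) p.257, (1.18)–(1.22) pp.263–264 (objects only; display of non-degeneracy)] -/
def RateObjects₁₁.Populated (o : RateObjects₁₁ N) : Prop := o.u3.Populated ∧ (∀ k, (o.ne3 k).Populated) ∧ ∀ k, (o.ne2 k).Populated

/-- Face (`Iff.rfl`). [cite: Balaban1987RG1, (0.24)–(0.25) p.257 (bookkeeping)] -/
theorem RateObjects₁₁.populated_iff (o : RateObjects₁₁ N) :
    o.Populated ↔ o.u3.Populated ∧ (∀ k, (o.ne3 k).Populated) ∧ ∀ k, (o.ne2 k).Populated := Iff.rfl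

/-- Projection: the U3 layer. [cite: Balaban1987RG1, (0.24)–(0.25) p.257 (bookkeeping)] -/
theorem RateObjects₁₁.Populated.u3 {o : RateObjects₁₁ N} (h : o.Populated) : o.u3.Populated := h.1

/-- Projection: the NE3 layer at run length `k`. [cite: Balaban1985UV3, (1)-(3) p.256 (bookkeeping)] -/
theorem RateObjects₁₁.Populated.ne3 {o : RateObjects₁₁ N} (h : o.Populated) (k : ℕ) : (o.ne3 k).Populated := h.2.1 k

/-- Projection: the NE2 layer at run length `k`. [cite: King1986, Prop. 3.9 (3.73) p.665 (bookkeeping)] -/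
theorem RateObjects₁₁.Populated.ne2 {o : RateObjects₁₁ N} (h : o.Populated) (k : ℕ) : (o.ne2 k).Populated := h.2.2 k

/-- **A residual rate assignment is POPULATED** when its objects are, at every family, Stage-11 parameter, tuned sequence and loop string (spelling of record:
`RateAssignment₁₁.Populated a`, full name). [cite: Balaban1987RG1, (1.18)–(1.22) pp.263–264 (objects only; display of non-degeneracy)] -/
def RateAssignment₁₁.Populated [NeZero N] (a : RateAssignment₁₁ N) : Prop :=
  ∀ (F : T4Family) (θ : Stage11Params F N) (g₀ : ℕ → ℝ) (os : List (ULoop F)), (a F θ g₀ os).Populated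

/-- Face (`Iff.rfl`). [cite: Balaban1987RG1, (1.18)–(1.22) pp.263–264 (bookkeeping)] -/
theorem RateAssignment₁₁.populated_iff [NeZero N] (a : RateAssignment₁₁ N) :
    RateAssignment₁₁.Populated a ↔ ∀ (F : T4Family) (θ : Stage11Params F N) (g₀ : ℕ → ℝ) (os : List (ULoop F)), (a F θ g₀ os).Populated := Iff.rfl

/-- **A residual spine assignment is POPULATED** when its objects are, at every argument (spelling `SpineAssignment₁₁.Populated a`). [cite: Balaban1987RG1, (0.24)–(0.27) pp.257–258 (objects only; display of non-degeneracy)] -/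
def SpineAssignment₁₁.Populated [NeZero N] (a : SpineAssignment₁₁ N) : Prop :=
  ∀ (F : T4Family) (θ : Stage11Params F N) (g₀ : ℕ → ℝ) (os : List (ULoop F)), (a F θ g₀ os).Populated

/-- Face (`Iff.rfl`). [cite: Balaban1987RG1, (0.24)–(0.27) pp.257–258 (bookkeeping)] -/
theorem SpineAssignment₁₁.populated_iff [NeZero N] (a : SpineAssignment₁₁ N) :
    SpineAssignment₁₁.Populated a ↔ ∀ (F : T4Family) (θ : Stage11Params F N) (g₀ : ℕ → ℝ) (os : List (ULoop F)), (a F θ g₀ os).Populated := Iff.rfl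

variable (N)

/-- **INHABITATION IS NOT POPULATEDNESS** (dag-ref-H READ-10 (A1), in the kernel): §7's sanity inhabitant satisfies the letter signs and is NOT populated — its NE2
index type is `PEmpty` and its NE3 data are `∅` — so `nonempty_rateObjects₁₁ ∕ nonempty_rateObjects₁₁_signs` carry NO content, and a reading that reduces to it
is a vacuity certificate, never a discharge. [cite: Balaban1987RG1, (1.20)–(1.22) p.264 (bookkeeping; display of non-degeneracy)] -/
theorem exists_signs_not_populated_rateObjects₁₁ : ∃ o : RateObjects₁₁ N, o.u3.Signs ∧ ¬ o.Populated := by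
  refine ⟨⟨trivialU3Objects₁₁, fun _ => trivialNE3Objects₁₁ N, fun _ => trivialNE2Objects₁₁⟩, trivialU3Letters₁₁_signs, fun h => ?_⟩
  obtain ⟨i⟩ := h.ne2 0
  exact PEmpty.elim i

/-- … while §7's trivial TOWER (one-point domain, zero functionals) IS populated: populatedness is NECESSARY for content, never sufficient.
[cite: Balaban1987RG1, (0.24)–(0.25) p.257 (bookkeeping; display of non-degeneracy)] -/
theorem exists_populated_u3Objects₁₁_signs : ∃ u : U3Objects₁₁, u.Signs ∧ u.Populated :=
  ⟨trivialU3Objects₁₁, trivialU3Letters₁₁_signs, fun _ => ⟨()⟩⟩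

end Populated

end Literature.MathematicalPhysics.QuantumFieldTheory.Balaban1983to89.Node00

end
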